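import Summits.QuantumFields.YangMills.Theorems.BalabanUVNodesN10AtRecord11
import Summits.QuantumFields.YangMills.Theorems.BalabanUVNodesN10RecordCensus

/-!
# BalabanUVNodes ∕ N10 AT THE STAGE-11 RECORD — THE SIDE FACES: WHY N10's KEY AT ₁₁ IS THE B13-RE-BOUND RECORD, NOT THE ROUTE's OWN `Rec`
# (Track A, DAG node N10 [Balaban1988RG2Cluster] Lemmas 1–3 pp. 9, 11, 20; R134 fan-out seat `pub-ymgap-dag-n10-d` strategy s2; companion of `BalabanUVNodesN10AtRecord11`)

HONEST FRAMING.  Count-neutral kernel bookkeeping BY NAME over LANDED modules: def-T's `Node00.Record11` (`IsRecordOfRecord₁₁C`), g31's `Record11Carriers`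
(`Stage11Params.rebindX`), dag-p2's `…N10RecordCensus` (the generic swap test `not_s_N10_of_swapClosed`, the θ-level witness `exists_swap_inEdges_not_b13`) and
this seat's `…N10AtRecord11` (`exists_rebindX_of_isRecordOfRecord₁₁C`, `b13_leaf_iff_rebindX`).  Over the route's own record predicate `Rec = Node00.IsRecordOfRecord₁₁C`
the B13 group `(θ.res.X P).S13 ∕ c13` — and the [B9] ∕ [B11] carriers the in-edges read — are STILL FREE residual fields of the Stage-11 view `θ.toStage5₁₁`; so,
GIVEN ONE ₁₁C record anywhere (the route's K0 as HYPOTHESIS, never asserted), the ∀-form `S_N10 (IsRecordOfRecord₁₁C · N)` is FALSE (§2) and the leaf `b13` ∕ the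
node `Dag.B13_main` are UNDETERMINED over the class (§3).  This is the ₁₁ instance of dag-p2's «every cumulative carrier-pinning record fails the S13-swap test
until the B13 group is itself pinned» — i.e. WHY the companion module keys N10 at the B13-RE-BOUND record (`s_N10_of_boundAtRebindS13`, the shape `CarriersB13`'s
record instantiates).  NO printed statement is refuted; nothing of Bałaban's is asserted; N10 NOT discharged; one finite T⁴ programme at fixed ε; nothing
continuum ∕ ℝ⁴ ∕ OS ∕ mass-gap ∕ Clay.  0 `sorry`, 0 `def`, standard axioms.  Filed `--supports` K1 (stmt-QuantumFields-19674).

WHAT THIS FILE PROVES.  §1 the X∕Y∕Z re-binding of Stage-11 parameters (inline structure update; provisos ∕ admissibility ∕ view ∕ datum transport, `rfl`s at a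
GENERIC re-binding per KERNEL LESSON 7), `isRecordOfRecord₁₁C_rebindXYZ`, `swapXYZ_of_isRecordOfRecord₁₁C` (₁₁C is CARRIER-SWAP CLOSED at the same datum);
§2 `not_s_N10_record₁₁C`, `not_flowBounds_record₁₁C` (given ₁₁C-inhabitation somewhere); §3 `exists_isRecordOfRecord₁₁C_b13_iff` (EVERY step-data family occurs as the
B13 group of some ₁₁C record at the family, given one), `exists_isRecordOfRecord₁₁C_b13_main` ∕ `exists_isRecordOfRecord₁₁C_not_b13_main`,
`b13_main_undetermined_over_record₁₁C`.
-/

noncomputable section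

namespace Summit.QuantumFields.YangMills.BalabanUVNodes.N10AtRecord11Sides

open Literature.MathematicalPhysics.QuantumFieldTheory.Balaban1983to89
open Literature.MathematicalPhysics.QuantumFieldTheory.Balaban1983to89.T4Continuum
open Literature.MathematicalPhysics.QuantumFieldTheory.Balaban1983to89.DagBinding
open Literature.MathematicalPhysics.QuantumFieldTheory.Balaban1983to89.Node00
open YMDAG.UVSplit (RecordPred AtRecord S_N10 FlowBounds)
open Summit.QuantumFields.YangMills.BalabanUVNodes.N08AtRecord11Sides (provisos₁₁_rebindX admissible_rebindX_iff)
open Summit.QuantumFields.YangMills.BalabanUVNodes.N10AtRecord11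
  (exists_rebindX_of_isRecordOfRecord₁₁C b13_leaf_iff_rebindX b13_main_iff_rebindX)
open Summit.QuantumFields.YangMills.Theorems.BalabanUVNodesN10RecordCensus (not_s_N10_of_swapClosed exists_swap_inEdges_not_b13)

variable {F : T4Family} {N : ℕ} [NeZero N]

/-! ## §1. The X∕Y∕Z re-binding of Stage-11 parameters: provisos, admissibility, the view and the datum do not read the carriers; ₁₁C is carrier-swap closed -/

section RebindXYZ

variable (θ : Stage11Params F N) (X' : B12.RunParams → PrintedCarriersR) (Y' : B12.RunParams → PrintedCarriers9X) (Z' : B12.RunParams → PrintedCarriers11)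

/-- The displayed Stage-11 provisos transport along ANY re-binding of the residual `X, Y, Z` families, field by field (the shape of g31's `Provisos₁₁.pinB10 ∕ pinY ∕ pinZ`
and n08-c's `provisos₁₁_rebindX`). [cite: Balaban1988Convergent, (3.2)–(3.9) pp.265–266, (2.23)–(2.42) pp.259–262 (the displayed provisos; bookkeeping)] -/
theorem provisos₁₁_rebindXYZ (h : θ.Provisos₁₁) :
    ({ θ with toStage9Params := { θ.toStage9Params with res := { θ.res with X := X', Y := Y', Z := Z' } } } : Stage11Params F N).Provisos₁₁ :=
  ⟨⟨h.base.intPiece, h.base.measω, h.base.measChi, h.base.zetaUnity, h.base.zetaAbs, fun p k _ hk => h.base.rstep p k hk, h.base.contT⟩,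
    h.rzLaws, h.wtLaws, h.alphaPos, h.bg⟩

/-- Admissibility reads no carrier (`Iff.rfl`). [cite: Balaban1987RG1, (1.12) p.262; Balaban1988Convergent, (2.34)–(2.39) p.261 (hypothesis dictionary; bookkeeping)] -/
theorem admissible_rebindXYZ_iff :
    ({ θ with toStage9Params := { θ.toStage9Params with res := { θ.res with X := X', Y := Y', Z := Z' } } } : Stage11Params F N).Admissible ↔
      θ.Admissible :=
  Iff.rfl

/-- The Stage-11 view of X∕Y∕Z-re-bound parameters IS the X∕Y∕Z-re-bound view (`rfl`: `residualOfStage11` keeps `X`, `Y`, `Z`).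
[cite: Balaban1988Convergent, p.244 (bookkeeping)] -/
theorem toStage5₁₁_rebindXYZ :
    ({ θ with toStage9Params := { θ.toStage9Params with res := { θ.res with X := X', Y := Y', Z := Z' } } } : Stage11Params F N).toStage5₁₁ F N =
      ({ θ.toStage5₁₁ F N with res := { (θ.toStage5₁₁ F N).res with X := X', Y := Y', Z := Z' } } : Stage5Params F N) :=
  rfl

/-- THE DATUM DOES NOT READ THE CARRIERS `X, Y, Z` (`rfl` at a generic re-binding). [cite: Balaban1989LargeFieldII, Thm 1 + (0.1) pp.355–356 (bookkeeping)] -/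
theorem datumOfRecord₁₁_rebindXYZ (h : θ.Provisos₁₁)
    (h' : ({ θ with toStage9Params := { θ.toStage9Params with res := { θ.res with X := X', Y := Y', Z := Z' } } } : Stage11Params F N).Provisos₁₁) :
    datumOfRecord₁₁ F N
        ({ θ with toStage9Params := { θ.toStage9Params with res := { θ.res with X := X', Y := Y', Z := Z' } } } : Stage11Params F N) h' =
      datumOfRecord₁₁ F N θ h :=
  rfl

/-- **Pointed form: a world bound at the C-binding over an X∕Y∕Z-RE-BOUND Stage-11 view is a Stage-11 record AT THE SAME DATUM.**
[cite: Balaban1989LargeFieldII, Thm 1 + (0.1) pp.355–356 (bookkeeping)] -/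
theorem isRecordOfRecord₁₁C_rebindXYZ (h : θ.Provisos₁₁) (hθ : θ.Admissible) (w : WorldP) (hC : w.C = (datumOfRecord₁₁ F N θ h).C)
    (hγ : 0 < w.γ ∧ w.γ ≤ θ.γ) (hL : w.L = (θ.L : ℝ))
    (hup : ∀ P, w.up P =
      upOfRecord₅C F N ({ θ.toStage5₁₁ F N with res := { (θ.toStage5₁₁ F N).res with X := X', Y := Y', Z := Z' } } : Stage5Params F N) P) :
    IsRecordOfRecord₁₁C F N (datumOfRecord₁₁ F N θ h) w := by
  refine ⟨{ θ with toStage9Params := { θ.toStage9Params with res := { θ.res with X := X', Y := Y', Z := Z' } } },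
    provisos₁₁_rebindXYZ θ X' Y' Z' h, (admissible_rebindXYZ_iff θ X' Y' Z').2 hθ, ?_, hC, hγ, hL, fun P => ?_⟩
  · exact (datumOfRecord₁₁_rebindXYZ θ X' Y' Z' h (provisos₁₁_rebindXYZ θ X' Y' Z' h)).symm
  · exact (hup P).trans (congrArg (upOfRecord₅C F N · P) (toStage5₁₁_rebindXYZ θ X' Y' Z').symm)

end RebindXYZ

/-- **THE ROUTE's `Rec = IsRecordOfRecord₁₁C` IS CARRIER-SWAP CLOSED AT THE SAME DATUM**: every ₁₁C record's world is bound over the Stage-5 view `θ.toStage5₁₁` of its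
parameters, and re-binding it over that view with ANY residual families `X′, Y′, Z′` is again a ₁₁C record of the SAME `D` — the hypothesis `hswap` of dag-p2's
generic test `…N10RecordCensus.not_s_N10_of_swapClosed`. [cite: Balaban1989LargeFieldII, Thm 1 + (0.1) pp.355–356 (bookkeeping)] -/
theorem swapXYZ_of_isRecordOfRecord₁₁C {D : FiniteEpsData F (SU N)} {w : WorldP} (hR : IsRecordOfRecord₁₁C F N D w) :
    ∃ θ₅ : Stage5Params F N, (∀ P, w.up P = upOfRecord₅C F N θ₅ P) ∧
      ∀ (X' : B12.RunParams → PrintedCarriersR) (Y' : B12.RunParams → PrintedCarriers9X) (Z' : B12.RunParams → PrintedCarriers11),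
        IsRecordOfRecord₁₁C F N D
          { w with up := fun P => upOfRecord₅C F N ({ θ₅ with res := { θ₅.res with X := X', Y := Y', Z := Z' } } : Stage5Params F N) P } := by
  obtain ⟨θ, hP, hθ, hD, hC, hγ, hL, hup⟩ := hR
  refine ⟨θ.toStage5₁₁ F N, hup, fun X' Y' Z' => ?_⟩
  rw [hD]
  exact isRecordOfRecord₁₁C_rebindXYZ θ X' Y' Z' hP hθ _ (by rw [← hD]; exact hC) hγ hL fun _ => rfl

/-! ## §2. The ∀-form of N10 over the route's own `Rec` is FALSE (given one ₁₁C record anywhere) -/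

/-- **`S_N10 (IsRecordOfRecord₁₁C · N)` IS FALSE AS SOON AS THE ₁₁C CLASS IS INHABITED ON SOME FAMILY** (the route's K0 somewhere, as HYPOTHESIS): dag-p2's generic test
`not_s_N10_of_swapClosed` at the swap closure of §1 — at some ₁₁C record every in-edge leaf `b9 b10 b11 b12` holds and `b13` fails at every run.  What this says:
N10's closer over the route's `Rec` must be keyed at a B13-PINNED record (`N10AtRecord11.s_N10_of_boundAtRebindS13`), exactly as N08's is keyed at the [B10]-pinned one.
[cite: Balaban1988RG2Cluster, Lemmas 1–3 pp.9, 11, 20 (bookkeeping: the universal form over the unpinned Stage-11 record is refutable)] -/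
theorem not_s_N10_record₁₁C (hK0 : ∃ (F : T4Family) (D : FiniteEpsData F (SU N)) (w : WorldP), IsRecordOfRecord₁₁C F N D w) :
    ¬ S_N10 (fun F D w => IsRecordOfRecord₁₁C F N D w) :=
  not_s_N10_of_swapClosed N _ hK0 fun F D w hR => by
    obtain ⟨θ₅, -, hsw⟩ := swapXYZ_of_isRecordOfRecord₁₁C hR
    exact ⟨θ₅, fun X' Y' Z' => ⟨D, hsw X' Y' Z'⟩⟩

/-- **K1's cluster statement «FlowBounds» over the route's own `Rec` is FALSE** (its N10 conjunct is), given ₁₁C-inhabitation somewhere.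
[cite: Balaban1988RG2Cluster, Lemmas 1–3 pp.9, 11, 20 (bookkeeping over the route's cluster statement)] -/
theorem not_flowBounds_record₁₁C (hK0 : ∃ (F : T4Family) (D : FiniteEpsData F (SU N)) (w : WorldP), IsRecordOfRecord₁₁C F N D w) :
    ¬ FlowBounds (fun F D w => IsRecordOfRecord₁₁C F N D w) :=
  fun h => not_s_N10_record₁₁C hK0 fun F D w hR P => (h F D w hR P).2.2.1

/-! ## §3. The leaf `b13` and the node are UNDETERMINED over the ₁₁C class (given one ₁₁C record at the family) -/

/-- **EVERY STEP-DATA FAMILY OCCURS AS THE B13 GROUP OF SOME ₁₁C RECORD AT THE FAMILY, GIVEN ONE**: the SAME datum with the world B13-re-bound to `(S, c)`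
(`N10AtRecord11.exists_rebindX_of_isRecordOfRecord₁₁C`), at every run of which `b13` IS the triple of `(S P, c)`.  A probe of the TYPING, not a statement about
Bałaban's step. [cite: Balaban1988RG2Cluster, Lemma 1 p.9, Lemma 2 p.11, Lemma 3 p.20 (typed leaf over the residual group; bookkeeping)] -/
theorem exists_isRecordOfRecord₁₁C_b13_iff (hK0 : ∃ (D : FiniteEpsData F (SU N)) (w : WorldP), IsRecordOfRecord₁₁C F N D w)
    (S : B12.RunParams → B13.StepData) (c : B13.Consts) :
    ∃ (D : FiniteEpsData F (SU N)) (w : WorldP), IsRecordOfRecord₁₁C F N D w ∧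
      ∀ P : B12.RunParams, ((leavesP w P).b13 ↔ B13.Lemma1Printed (S P) c ∧ B13.Lemma2Printed (S P) c ∧ B13.Lemma3Printed (S P) c) := by
  obtain ⟨D, w, hR⟩ := hK0
  let X13 : Stage11Params F N → B12.RunParams → PrintedCarriersR := fun θ P => { θ.res.X P with S13 := S P, c13 := c }
  obtain ⟨θ, -, -, -, -, hR'⟩ := exists_rebindX_of_isRecordOfRecord₁₁C hR X13
  exact ⟨D, _, hR', fun P => b13_leaf_iff_rebindX F N (θ.toStage5₁₁ F N) (X13 θ) _ P rfl⟩

/-- **At some ₁₁C record (given one at the family) N10 HOLDS AT EVERY RUN — DEGENERATELY**: the B13 group re-bound to the EMPTY step data of dag-p2's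
`B13ResidualSlotProbe.exists_stepData_b13Triple` (Lemmas 1–3 vacuous as typed; REUSED by name). [cite: Balaban1988RG2Cluster, Lemmas 1–3 pp.9, 11, 20 (typing; bookkeeping witness)] -/
theorem exists_isRecordOfRecord₁₁C_b13_main (hK0 : ∃ (D : FiniteEpsData F (SU N)) (w : WorldP), IsRecordOfRecord₁₁C F N D w) :
    ∃ (D : FiniteEpsData F (SU N)) (w : WorldP), IsRecordOfRecord₁₁C F N D w ∧ ∀ P : B12.RunParams, Dag.B13_main (leavesP w P) := by
  obtain ⟨D, w, hR⟩ := hK0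
  obtain ⟨Sj, hSj⟩ := B13ResidualSlotProbe.exists_stepData_b13Triple
  obtain ⟨θ, -, -, -, -, hR'⟩ := exists_rebindX_of_isRecordOfRecord₁₁C hR fun θ P => { θ.res.X P with S13 := Sj }
  exact ⟨D, _, hR', fun P =>
    (b13_main_iff_rebindX F N (θ.toStage5₁₁ F N) (fun P => { θ.res.X P with S13 := Sj }) _ P rfl).2 fun _ _ _ _ => hSj _⟩

/-- **At some ₁₁C record (given one at the family) N10 FAILS AT EVERY RUN**: the residual `X, Y, Z` swapped to dag-p2's θ-level witness (`exists_swap_inEdges_not_b13`: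
in-edges `b9 b10 b11 b12` true, `b13` false) — a ₁₁C record by §1. [cite: Balaban1988RG2Cluster, Lemmas 1–3 pp.9, 11, 20; p.1 (in-edges) (bookkeeping witness)] -/
theorem exists_isRecordOfRecord₁₁C_not_b13_main (hK0 : ∃ (D : FiniteEpsData F (SU N)) (w : WorldP), IsRecordOfRecord₁₁C F N D w) :
    ∃ (D : FiniteEpsData F (SU N)) (w : WorldP), IsRecordOfRecord₁₁C F N D w ∧ ∀ P : B12.RunParams, ¬ Dag.B13_main (leavesP w P) := by
  obtain ⟨D, w, hR⟩ := hK0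
  obtain ⟨θ₅, -, hsw⟩ := swapXYZ_of_isRecordOfRecord₁₁C hR
  obtain ⟨X', Y', Z', hw⟩ := exists_swap_inEdges_not_b13 N θ₅
  refine ⟨D, _, hsw X' Y' Z', fun P h => ?_⟩
  have hl := hw { w with up := fun P => upOfRecord₅C F N ({ θ₅ with res := { θ₅.res with X := X', Y := Y', Z := Z' } } : Stage5Params F N) P }
    P rfl
  exact hl.2.2.2.2 (h hl.1 hl.2.1 hl.2.2.1 hl.2.2.2.1)

/-- **N10 IS UNDETERMINED OVER THE ROUTE's `Rec` AT STAGE 11** (given one ₁₁C record at the family): some record has `Dag.B13_main` at every run, some has its negation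
at every run — the B13 group is residual free data of `θ.toStage5₁₁`; the pin (`CarriersB13`) is what makes the node a statement about Bałaban's step.
[cite: Balaban1988RG2Cluster, Lemmas 1–3 pp.9, 11, 20 (bookkeeping: census of the typed node over the unpinned Stage-11 record)] -/
theorem b13_main_undetermined_over_record₁₁C (hK0 : ∃ (D : FiniteEpsData F (SU N)) (w : WorldP), IsRecordOfRecord₁₁C F N D w) :
    (∃ (D : FiniteEpsData F (SU N)) (w : WorldP), IsRecordOfRecord₁₁C F N D w ∧ ∀ P : B12.RunParams, Dag.B13_main (leavesP w P)) ∧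
      ∃ (D : FiniteEpsData F (SU N)) (w : WorldP), IsRecordOfRecord₁₁C F N D w ∧ ∀ P : B12.RunParams, ¬ Dag.B13_main (leavesP w P) :=
  ⟨exists_isRecordOfRecord₁₁C_b13_main hK0, exists_isRecordOfRecord₁₁C_not_b13_main hK0⟩

end Summit.QuantumFields.YangMills.BalabanUVNodes.N10AtRecord11Sides

end
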